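import Mathlib
import Summits.Ventures.HodgeRepro.LitHurwitzZero

/-!
# LitLFunctionZero — `L(χ, 0) = −(1/N)·Σ χ(j)·j`, and `L(χ, 0) ≠ 0` for odd `χ` of prime modulus

Blind cell `pub-hodge-repro`, seat lit-2 (gen 6).  Built on Mathlib and `LitHurwitzZero.lean`
(same seat: `ζ(0, a) = 1/2 − a` for `0 < a ≤ 1`).

* `LFunction_zero_eq`: `L(Φ, 0) = Σ_j Φ(j)·(1/2 − j/N)` for any `Φ : ZMod N → ℂ` with `Φ(0) = 0`
  (Mathlib's `ZMod.LFunction` is `N^{−s}·Σ_j Φ(j)·ζ(s, j/N)`);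
* `LFunction_zero_eq_neg_sum_div`: **`L(χ, 0) = −(1/N)·Σ_{j mod N} χ(j)·j`** for a nontrivial
  Dirichlet character `χ` mod `N` — i.e. `L(0, χ) = −B_{1,χ}` (Washington, *Introduction to
  Cyclotomic Fields*, Thm 4.2 with `n = 1`; proved here from `ζ(0, a) = 1/2 − a` and
  `Σ_j χ(j) = 0`);
* `isPrimitive_of_prime`, `Odd.ne_one'`: a nontrivial character of prime modulus is primitive; an
  odd character is nontrivial;
* `LFunction_zero_ne_zero_of_odd`: **`L(χ, 0) ≠ 0`** for an odd Dirichlet character of prime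
  modulus — Mathlib's functional equation
  `DirichletCharacter.IsPrimitive.completedLFunction_one_sub` at `s = 1`, the root number `≠ 0`
  because the Gauss sum is (`gaussSum_ne_zero_of_nontrivial`), and
  `DirichletCharacter.LFunction_apply_one_ne_zero` for `χ⁻¹`.

`LitRankTheta.lean` (same seat) specialises this to Kubota's `Θ = Σ_{a=1}^{p−1} ψ(a)·a`.
-/

namespace HodgeRepro.Lit2.HurwitzZero

open Complex Real Set MeasureTheory Filter Topology HurwitzZeta

/-! ### Dirichlet L-functions at `s = 0` -/

/-- **`L(Φ, 0)` for a function on `ZMod N` vanishing at `0`**: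
`L(Φ, 0) = Σ_j Φ(j)·(1/2 − j/N)` (`j` running over the residues `0 ≤ j < N`). -/
theorem LFunction_zero_eq {N : ℕ} [NeZero N] (Φ : ZMod N → ℂ) (hΦ : Φ 0 = 0) :
    ZMod.LFunction Φ 0 = ∑ j : ZMod N, Φ j * (1 / 2 - (j.val : ℂ) / N) := by
  unfold ZMod.LFunction
  rw [neg_zero, cpow_zero, one_mul]
  refine Finset.sum_congr rfl fun j _ => ?_
  rcases eq_or_ne j 0 with rfl | hj
  · simp [hΦ]
  · have hN : (0 : ℝ) < N := Nat.cast_pos.mpr (NeZero.pos _)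
    have hj0 : 0 < (j.val : ℝ) := by
      exact_mod_cast Nat.pos_of_ne_zero ((ZMod.val_ne_zero j).2 hj)
    have hj1 : (j.val : ℝ) / N ≤ 1 := (div_le_one hN).2 (by exact_mod_cast (ZMod.val_lt j).le)
    rw [ZMod.toAddCircle_apply, hurwitzZeta_zero_eq (j.val / N) (div_pos hj0 hN) hj1]
    push_cast
    ring

/-- **`L(χ, 0) = −(1/N)·Σ_j χ(j)·j`** for a nontrivial Dirichlet character mod `N`
(the generalised Bernoulli number `B_{1,χ}` up to sign). -/
theorem LFunction_zero_eq_neg_sum_div {N : ℕ} [NeZero N] (hN : N ≠ 1)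
    (χ : DirichletCharacter ℂ N) (hχ : χ ≠ 1) :
    DirichletCharacter.LFunction χ 0 = -(∑ j : ZMod N, χ j * (j.val : ℂ)) / N := by
  rw [DirichletCharacter.LFunction, LFunction_zero_eq (χ ·) (χ.map_zero' hN)]
  have hsum : ∑ j : ZMod N, χ j = 0 := MulChar.sum_eq_zero_of_ne_one hχ
  have hN' : (N : ℂ) ≠ 0 := by exact_mod_cast NeZero.ne N
  have hterm : ∀ j : ZMod N, χ j * (1 / 2 - (j.val : ℂ) / N)
      = (1 / 2) * χ j - (χ j * (j.val : ℂ)) / N := fun j => by ring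
  simp_rw [hterm, Finset.sum_sub_distrib, ← Finset.mul_sum, hsum, mul_zero, zero_sub,
    ← Finset.sum_div, neg_div]

/-- a nontrivial Dirichlet character of prime modulus is primitive. -/
theorem isPrimitive_of_prime {p : ℕ} [hp : Fact p.Prime] (χ : DirichletCharacter ℂ p)
    (hχ : χ ≠ 1) : χ.IsPrimitive := by
  rw [DirichletCharacter.isPrimitive_def]
  rcases (Nat.dvd_prime hp.out).1 χ.conductor_dvd_level with h | h
  · exact absurd (DirichletCharacter.eq_one_iff_conductor_eq_one.2 h) hχ
  · exact h

/-- an odd Dirichlet character is nontrivial. -/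
theorem Odd.ne_one' {N : ℕ} {χ : DirichletCharacter ℂ N} (hχ : χ.Odd) : χ ≠ 1 := by
  intro h
  rw [DirichletCharacter.Odd, h, MulChar.one_apply (isUnit_one.neg)] at hχ
  norm_num at hχ

/-- **Non-vanishing of `L(χ, 0)` for an odd Dirichlet character of prime modulus** (functional
equation + `L(χ̄, 1) ≠ 0` + non-vanishing of the Gauss sum). -/
theorem LFunction_zero_ne_zero_of_odd {p : ℕ} [hp : Fact p.Prime] (χ : DirichletCharacter ℂ p)
    (hχ : χ.Odd) : DirichletCharacter.LFunction χ 0 ≠ 0 := by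
  have hχ1 : χ ≠ 1 := Odd.ne_one' hχ
  have hp1 : p ≠ 1 := hp.out.one_lt.ne'
  have hp0 : (p : ℂ) ≠ 0 := by exact_mod_cast hp.out.ne_zero
  have hprim : χ.IsPrimitive := isPrimitive_of_prime χ hχ1
  have hFE := hprim.completedLFunction_one_sub 1
  rw [sub_self] at hFE
  rw [DirichletCharacter.LFunction_eq_completed_div_gammaFactor χ 0 (Or.inr hp1),
    hχ.gammaFactor_def, zero_add, Gammaℝ_one, div_one, hFE]
  refine mul_ne_zero (mul_ne_zero ?_ ?_) ?_
  · exact cpow_ne_zero_iff.mpr (Or.inl hp0)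
  · unfold DirichletCharacter.rootNumber
    refine div_ne_zero (div_ne_zero ?_ (pow_ne_zero _ I_ne_zero)) ?_
    · have hcard : ((Fintype.card (ZMod p) : ℕ) : ℂ) ≠ 0 := by
        rw [ZMod.card]; exact hp0
      exact gaussSum_ne_zero_of_nontrivial hcard hχ1 (ZMod.isPrimitive_stdAddChar p)
    · exact cpow_ne_zero_iff.mpr (Or.inl hp0)
  · intro h0
    have h1 := DirichletCharacter.LFunction_apply_one_ne_zero (inv_ne_one.2 hχ1)
    rw [DirichletCharacter.LFunction_eq_completed_div_gammaFactor χ⁻¹ 1 (Or.inl one_ne_zero),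
      h0, zero_div] at h1
    exact h1 rfl

end HodgeRepro.Lit2.HurwitzZero
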